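import Summits.Ventures.HodgeRepro2.T5RecordSatakeInert
import Summits.Ventures.HodgeRepro2.T5InertDegreeAdicCompletion
import Summits.Ventures.HodgeRepro2.T5FinitePlaceSplitIff
import Summits.Ventures.HodgeRepro2.T5CMFieldSquareDatum
import Summits.Ventures.HodgeRepro2.T5NonSplitPlaceUnitaryGroup
import Mathlib.NumberTheory.NumberField.Cyclotomic.Ideal

/-!
# The prime `3` stays prime in the sextic field of record `ℚ(ζ₇)`, and the place `(3)` of `ℚ(ζ₇)⁺` has norm `27`

Tier-5 support N3 / §G-N4.2 (seat p3, gen 78). The Satake chain of the record's own pair is a theorem of the tree at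
every place of `K⁺` that stays prime in the CM field `K` (files 233–252, inhabited so far on `ℚ(i)`). This file
exhibits such a place on the FIELD OF RECORD `ℚ(ζ₇)`: the prime `3` has order `6 = [ℚ(ζ₇) : ℚ]` modulo `7`, so its
inertia degree in `ℚ(ζ₇)` is `6` (Mathlib's `IsCyclotomicExtension.Rat.inertiaDeg_eq_of_not_dvd`) and `(3)` is a
prime of `𝓞_{ℚ(ζ₇)}` — the unique prime above `3`, of norm `3⁶ = 729`; its contraction to `ℚ(ζ₇)⁺` is a place `v`
with `v 𝓞_{ℚ(ζ₇)} = (3)` and `N(v) = 27` (`N(w) = N(v)^{f(w/v)}` with `f = 2`, file 207's `absNorm_eq_sq`):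

* `orderOf_three_zmod_seven` — `3` has order `6` modulo `7`; `finrank_rat_seven` — `[ℚ(ζ₇) : ℚ] = 6`;
* `absNorm_span_three_int`, `absNorm_span_three` — `N((3)) = 3` in `ℤ`, `= 729` in `𝓞_{ℚ(ζ₇)}`;
* `eq_of_le_of_absNorm_eq` — two non-zero ideals of a Dedekind domain, one below the other, with equal norms, are
  equal; `absNorm_of_liesOver_three` — every prime of `𝓞_{ℚ(ζ₇)}` above `3` has norm `729`;
* **`isPrime_span_three`**, **`prime_three`** — `(3)` is a prime of `𝓞_{ℚ(ζ₇)}`;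
* `wThreeSeven`, `vThreeSeven`, `liesOver_vThreeSeven`, **`map_vThreeSeven`** — the places `(3)` of `ℚ(ζ₇)` and
  of `ℚ(ζ₇)⁺`, and «`v 𝓞_K = w`»;
* **`absNorm_vThreeSeven`** — `N(vThreeSeven) = 27`.

§8(d): uses an L-value-free non-vanishing device: NO.
-/

open NumberField NumberField.IsCMField IsDedekindDomain IsDedekindDomain.HeightOneSpectrum Module Polynomial
open Summit.Ventures.HodgeRepro2.T5RecordSatakeInert Summit.Ventures.HodgeRepro2.T5InertDegreeAdicCompletion
  Summit.Ventures.HodgeRepro2.T5FinitePlaceSplitIff Summit.Ventures.HodgeRepro2.T5InertGlobalPrime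
  Summit.Ventures.HodgeRepro2.T5FinitePlaceCM Summit.Ventures.HodgeRepro2.T5FinitePlaceNormIndex
  Summit.Ventures.HodgeRepro2.T5CMFieldSquareDatum Summit.Ventures.HodgeRepro2.T5NonSplitPlaceUnitaryGroup

namespace Summit.Ventures.HodgeRepro2.T5CyclotomicSevenInertThree

section Arithmetic

/-- `3` has multiplicative order `6` modulo `7`. -/
theorem orderOf_three_zmod_seven : orderOf (3 : ZMod 7) = 6 := by
  rw [orderOf_eq_iff (by norm_num)]
  decide

/-- `N((3)) = 3` in `ℤ`. -/
theorem absNorm_span_three_int : Ideal.absNorm (Ideal.span {(3 : ℤ)}) = 3 := by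
  have h := Ideal.absNorm_span_natCast (S := ℤ) 3
  rw [Nat.cast_ofNat, Module.finrank_self, pow_one] at h
  exact h

/-- Two non-zero ideals of a Dedekind domain, one below the other, with the same absolute norm, are equal. -/
theorem eq_of_le_of_absNorm_eq {S : Type*} [CommRing S] [IsDedekindDomain S] [Module.Free ℤ S]
    [Module.Finite ℤ S] [Infinite S] {I J : Ideal S} (hle : I ≤ J) (hI : I ≠ ⊥)
    (h : Ideal.absNorm I = Ideal.absNorm J) : I = J := by
  obtain ⟨C, hC⟩ := Ideal.dvd_iff_le.mpr hle
  have hJ : Ideal.absNorm J ≠ 0 := by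
    intro h0
    exact hI ((Ideal.absNorm_eq_zero_iff).mp (h.trans h0))
  have hC1 : Ideal.absNorm C = 1 := by
    have h2 : Ideal.absNorm I = Ideal.absNorm J * Ideal.absNorm C := by rw [hC, map_mul]
    rw [h] at h2
    exact (Nat.mul_eq_left hJ).mp h2.symm
  rw [hC, Ideal.absNorm_eq_one_iff.mp hC1, Ideal.mul_top]

end Arithmetic

section Seven

variable (K : Type*) [Field K] [CharZero K] [IsCyclotomicExtension {7} ℚ K]

/-- `ℚ(ζ₇)` is a number field (as a theorem, to `haveI` inside statements). -/
theorem numberField' : NumberField K := IsCyclotomicExtension.numberField {7} ℚ K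

/-- `ℚ(ζ₇)` is a CM field (Mathlib's `IsCyclotomicExtension.Rat.isCMField`). -/
theorem isCMField' : IsCMField K := IsCyclotomicExtension.Rat.isCMField K (S := {7}) ⟨7, rfl, by norm_num⟩

/-- `[ℚ(ζ₇) : ℚ] = φ(7) = 6`. -/
theorem finrank_rat_seven : Module.finrank ℚ K = 6 := by
  rw [IsCyclotomicExtension.Rat.finrank 7 K, Nat.totient_prime (by norm_num)]

/-- `N((3)) = 3⁶ = 729` in `𝓞_{ℚ(ζ₇)}`. -/
theorem absNorm_span_three :
    haveI := numberField' K
    Ideal.absNorm (Ideal.span {(3 : 𝓞 K)}) = 729 := by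
  haveI := numberField' K
  have h := Ideal.absNorm_span_natCast (S := 𝓞 K) 3
  rw [Nat.cast_ofNat, RingOfIntegers.rank, finrank_rat_seven K] at h
  exact h

/-- **Every prime of `𝓞_{ℚ(ζ₇)}` above `3` has norm `729`**: its inertia degree is the order of `3` modulo `7`, which
is `6` (Mathlib's `IsCyclotomicExtension.Rat.inertiaDeg_eq_of_not_dvd`), and `N(P) = N((3))^{f}`. -/
theorem absNorm_of_liesOver_three (P : Ideal (𝓞 K)) [P.IsPrime] [P.LiesOver (Ideal.span {(3 : ℤ)})] :
    haveI := numberField' K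
    Ideal.absNorm P = 729 := by
  haveI := numberField' K
  have hf : P.inertiaDeg ℤ = 6 := by
    rw [IsCyclotomicExtension.Rat.inertiaDeg_eq_of_not_dvd (m := 7) 3 K P (by norm_num), Nat.cast_ofNat,
      orderOf_three_zmod_seven]
  have h := Ideal.absNorm_pow_inertiaDeg (Ideal.span {(3 : ℤ)}) P
  rw [absNorm_span_three_int, hf] at h
  exact h.symm

/-- **`(3)` is a prime of `𝓞_{ℚ(ζ₇)}`**: it lies below some prime `P` above `3`, both have norm `729`, so they are
equal. -/
theorem isPrime_span_three :
    haveI := numberField' K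
    (Ideal.span {(3 : 𝓞 K)}).IsPrime := by
  haveI := numberField' K
  haveI : (Ideal.span {(3 : ℤ)}).IsPrime := (Ideal.span_singleton_prime (by norm_num)).mpr Int.prime_three
  obtain ⟨⟨P, hP, hPo⟩⟩ := Ideal.nonempty_primesOver (S := 𝓞 K) (Ideal.span {(3 : ℤ)})
  have hle : Ideal.span {(3 : 𝓞 K)} ≤ P := by
    rw [Ideal.span_le, Set.singleton_subset_iff, SetLike.mem_coe]
    have h3 : (3 : ℤ) ∈ Ideal.span {(3 : ℤ)} := Ideal.mem_span_singleton_self 3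
    rw [Ideal.mem_of_liesOver P (Ideal.span {(3 : ℤ)}) 3, map_ofNat] at h3
    exact h3
  have hne : Ideal.span {(3 : 𝓞 K)} ≠ ⊥ := (Ideal.span_singleton_eq_bot).not.mpr (by norm_num)
  have heq : Ideal.span {(3 : 𝓞 K)} = P :=
    eq_of_le_of_absNorm_eq hle hne ((absNorm_span_three K).trans (absNorm_of_liesOver_three K P).symm)
  rw [heq]
  exact hP

/-- `3` is a prime element of `𝓞_{ℚ(ζ₇)}`. -/
theorem prime_three :
    haveI := numberField' K
    Prime (3 : 𝓞 K) := by
  haveI := numberField' K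
  exact (Ideal.span_singleton_prime (by norm_num)).mp (isPrime_span_three K)

/-- **The place `(3)` of `ℚ(ζ₇)`.** -/
noncomputable def wThreeSeven : HeightOneSpectrum (𝓞 K) :=
  haveI := numberField' K
  { asIdeal := Ideal.span {(3 : 𝓞 K)}
    isPrime := isPrime_span_three K
    ne_bot := (Ideal.span_singleton_eq_bot).not.mpr (by norm_num) }

/-- The ideal of `wThreeSeven` is `(3)`. -/
theorem wThreeSeven_asIdeal : (wThreeSeven K).asIdeal = Ideal.span {(3 : 𝓞 K)} := rfl

/-- `3 ∈ wThreeSeven`. -/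
theorem three_mem_wThreeSeven : (3 : 𝓞 K) ∈ (wThreeSeven K).asIdeal := Ideal.mem_span_singleton_self 3

omit [IsCyclotomicExtension {7} ℚ K] in
/-- `3 ≠ 0` in `𝓞_{ℚ(ζ₇)}`. -/
theorem three_ne_zero' : (3 : 𝓞 K) ≠ 0 := by norm_num

/-- **The place `(3)` of `ℚ(ζ₇)⁺ = maximalRealSubfield ℚ(ζ₇)`**, constructed as the contraction of `wThreeSeven`. -/
noncomputable def vThreeSeven : HeightOneSpectrum (𝓞 (maximalRealSubfield K)) where
  asIdeal := Ideal.comap (algebraMap (𝓞 (maximalRealSubfield K)) (𝓞 K)) (wThreeSeven K).asIdeal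
  isPrime := Ideal.IsPrime.comap _
  ne_bot := Ideal.comap_ne_bot_of_integral_mem (three_ne_zero' K) (three_mem_wThreeSeven K)
    (Algebra.IsIntegral.isIntegral _)

/-- The ideal of `vThreeSeven` is the contraction of `(3)`. -/
theorem vThreeSeven_asIdeal :
    (vThreeSeven K).asIdeal =
      Ideal.comap (algebraMap (𝓞 (maximalRealSubfield K)) (𝓞 K)) (wThreeSeven K).asIdeal :=
  rfl

/-- `3 ∈ vThreeSeven`. -/
theorem three_mem_vThreeSeven : (3 : 𝓞 (maximalRealSubfield K)) ∈ (vThreeSeven K).asIdeal := by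
  rw [vThreeSeven_asIdeal, Ideal.mem_comap, map_ofNat]
  exact three_mem_wThreeSeven K

/-- `wThreeSeven K` lies over `vThreeSeven K`. -/
instance liesOver_vThreeSeven : (wThreeSeven K).asIdeal.LiesOver (vThreeSeven K).asIdeal := ⟨rfl⟩

/-- **`3` stays prime in `ℚ(ζ₇)`, from `ℚ(ζ₇)⁺`**: `(3) 𝓞_K = (3)` — the hypothesis `hmap` of files 233 / 236 at the
concrete place (`map (comap w) ≤ w` always; `(3) = span {3} ≤ map (comap w)` because `3 ∈ comap w`). -/
theorem map_vThreeSeven :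
    Ideal.map (algebraMap (𝓞 (maximalRealSubfield K)) (𝓞 K)) (vThreeSeven K).asIdeal =
      (wThreeSeven K).asIdeal := by
  refine le_antisymm Ideal.map_comap_le ?_
  rw [wThreeSeven_asIdeal, Ideal.span_le, Set.singleton_subset_iff]
  have h := Ideal.mem_map_of_mem (algebraMap (𝓞 (maximalRealSubfield K)) (𝓞 K)) (three_mem_vThreeSeven K)
  rwa [map_ofNat] at h

/-- **`N(vThreeSeven) = 27`**: `N(w) = N(v)^{f(w/v)}` with `f(w/v) = 2` (file 207's `absNorm_eq_sq`, `e = 1` from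
«stays prime» and `[K_w : K⁺_v] = 2` from «`θ` is not a `v`-adic square», both consequences of `v 𝓞_K = w`), and
`N(w) = 729 = 27²`. -/
theorem absNorm_vThreeSeven :
    haveI := numberField' K; haveI := isCMField' K
    Ideal.absNorm (vThreeSeven K).asIdeal = 27 := by
  haveI := numberField' K
  haveI := isCMField' K
  have he := ramificationIdx'_eq_one_of_staysPrime (vThreeSeven K) (wThreeSeven K) (map_vThreeSeven K)
  obtain ⟨θ, y, hθ, hy⟩ := exists_sq_eq_and_complexConj_ne K
  have hf := finrank_eq_two K (vThreeSeven K) (wThreeSeven K) hθ hy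
    (not_isSquare_of_staysPrime K (vThreeSeven K) (wThreeSeven K) hθ hy (map_vThreeSeven K))
  have h := absNorm_eq_sq (vThreeSeven K) (wThreeSeven K) he hf
  rw [wThreeSeven_asIdeal, absNorm_span_three K] at h
  have h27 : (729 : ℕ) = 27 ^ 2 := by norm_num
  rw [h27] at h
  exact (Nat.pow_left_injective two_ne_zero h).symm

end Seven

end Summit.Ventures.HodgeRepro2.T5CyclotomicSevenInertThree
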